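import Literature.MathematicalPhysics.QuantumLattice.TorusGibbsTwoSectorFreeEnergyComparison
import Literature.MathematicalPhysics.QuantumLattice.InfVolFermionStateTorusLimitTwoSectorCompanionChain
import Literature.MathematicalPhysics.QuantumLattice.InfVolFermionStateTorusLimitTwoSectorRatioBracket
import Literature.MathematicalPhysics.QuantumLattice.HubbardTTPrimeEnergyDensityVariationalPrinciple
import HarnessLib

/-!
# Energy-window rows of the COMPANION states of the two-sector energy–entropy balance: the companion
# lives in the same thermal energy window as the object of record

Topic `Literature/MathematicalPhysics/QuantumLattice`; complement of `TorusSectorGibbsMixture.lean` §3/§5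
(the N2′ energy–entropy cap `e_Φ(ω) ≤ e(t,t',U,n) + 2H_b(n/2)/β` and the variational floor for the thermal
object of record `ω` — torus limits of the canonical `(rectN n L, S^z = 0)` Gibbs states) and of the
two-sector files `…TwoSectorCompanionExistence / …RatioBracket / …CompanionChain` (the companion torus limits
`ω'` of the canonical states of the image sectors `(k_L − 1, k_L)`, their existence, `r > 0`). A certificate
about `ω'` (needed e.g. to bound the energy moment `g'` of the a-priori bracket, or in a two-state relaxation)
wants ENERGY-WINDOW rows for `ω'`; this file proves them:

* (finite-volume free-energy bookkeeping and the abstract TD-limit comparison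
  `IsTorusLimitOfMixture.meanEnergy_le_meanEnergy_add_of_partitionRatio` live in
  `TorusGibbsTwoSectorFreeEnergyComparison.lean`;)
* §1 for a GIVEN pair `(ω, ω')` (record object, `(k_L − 1, k_L)` companion, same `Ls`, `0 < n < 2`) the ratio
  converges to some `r > 0` along a subsequence
  (`…exists_tendsto_partitionFn_ratio_pos_of_predCompanion`; Bolzano–Weierstrass for `u = r/(1+r)` and the
  rows/reversed rows with vanishing fugacity term); the companion sector has entropy density `2H_b(n/2)`
  (`card_subtype_spinConfig_le_choose_mul`, `eventually_log_card_spinConfig_predCompanion_le`);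
* §2 BY NAME, hypothesis-free (`β > 0`, `0 < n < 2`; `U ≥ 0` where stated):
  `e_Φ(ω') ≤ e_Φ(ω) + 2H_b(n/2)/β` (`…meanEnergy_predCompanion_le_meanEnergy_add`),
  `e_Φ(ω) ≤ e_Φ(ω') + 2H_b(n/2)/β` (`…meanEnergy_le_meanEnergy_predCompanion_add`),
  the FLOOR `e(n) ≤ e_Φ(ω')` (translation invariance + density `n/2 + n/2 = n` + the variational principle),
  the CAP `e_Φ(ω') ≤ e(n) + 2H_b(n/2)/β` (`F(P) ≤ E₀(P)` and `E₀(L; rectN n L)/L² → e(n)`), assembled as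
  `…meanEnergy_predCompanion_mem_Icc`: the companion obeys EXACTLY the N2′ window of the object of record,
  so the `T = 0` filling-box energy rows (caps/floors on `e(n)`) transport to the companion classes verbatim.

HONEST SCOPE: thermal energy windows only (no number); pairs of states along a common side sequence; no claim
`ω' = ω`; the relative bounds need no sign of `U`, the absolute ones need `U ≥ 0` (the tree's variational
principle / TD limit of `e`). Everything is PROVED; no definition, no named fact.

## Mathlib / tree search

REUSED: `Matrix.neg_sum_mul_log_le` (`DuhamelTwoPoint`), `log_choose_le_mul_binEntropy`,
`eventually_log_sectorGibbsCount_le`, `re_rayleigh_sectorEigenvector`, `groundEnergy_submatrix_le_minEnergyOn`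
(`TorusSectorGibbsMixture`), `Matrix.groundEnergy_eq_iInf_eigenvalues_holds` (`FinDimSpectrum`),
`groundEnergy_hubbardTorusTT'_eq_minEnergyOn_szSector`, `tendsto_energyDensityTT'_torus`,
`IsTorusLimitOfMixture.tendsto_meanEnergy_hubbardTTPrime` (`TorusLimitOfMixtures`),
`energyDensityTT'_le_meanEnergy_of_isTranslationInvariant` (`HubbardTTPrimeEnergyDensityVariationalPrinciple`),
`…twoSector_row_annihilation_up_densities_of_sectorGibbs`, `partitionFn_ratio_predCompanion_pos`,
`…pos_of_tendsto_partitionFn_ratio_predCompanion` (`…RatioBracket`), `…creation_up_reverse_nonneg_of_sectorGibbs`,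
densities (`…ReverseRow`, `…CompanionChain`), Mathlib `Real.binEntropy_continuous`, `tendsto_subseq_of_bounded`,
`Filter.Tendsto.div_atTop`, `Real.continuousAt_log`. `lean search 'gibbsMean|predCompanion_le'`: nothing (2026-08-27).

## References

* R. B. Israel, *Convexity in the Theory of Lattice Gases* (1979), Lemma II.3.1 (energy–entropy inequalities
  for finite Gibbs states), §I.3 eq. (26). [cite: Israel1979, Lemma II.3.1]
* O. Bratteli, D. W. Robinson, *OAQSM 2* (1997), §5.4.2 (chemical potential as a free-energy difference).
  [cite: BratteliRobinsonII1997, §5.4.2]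
* D. Ruelle, *Statistical Mechanics: Rigorous Results* (1969), §3.4. [cite: Ruelle1969, §3.4]
* H. Fawzi, O. Fawzi, S. O. Scalet (2024), Thm. 3.1. [cite: FawziFawziScalet2024, Thm. 3.1]
* H. Tasaki, *Physics and Mathematics of Quantum Many-Body Systems* (2020), §2.2. [cite: Tasaki2020, §2.2]
* E. H. Lieb, Phys. Rev. Lett. 62 (1989) 1201, proof of Thm. 1. [cite: LiebPRL1989, proof of Theorem 1]
-/

noncomputable section

namespace Literature.MathematicalPhysics.QuantumLattice

open Matrix Finset HubbardWave0 Literature.Probability.LatticeModels ThermodynamicLimit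
open _root_.Filter
open scoped _root_.Topology ComplexOrder BigOperators

/-! ### §1 The «rm↑» companion `(k_L − 1, k_L)` of the thermal object of record: the ratio converges to a
positive number along a subsequence for a GIVEN pair; entropy of the companion sector -/

section PredCompanion

variable (t t' U β : ℝ)

/-- `0 ≤ r/(1+r) ≤ 1` for `0 ≤ r`. [folklore] -/
private theorem div_one_add_mem_Icc' {r : ℝ} (hr : 0 ≤ r) : r / (1 + r) ∈ Set.Icc (0 : ℝ) 1 :=
  ⟨div_nonneg hr (by positivity), (div_le_one (by positivity)).2 (by linarith)⟩

/-- If `r_j/(1+r_j) → u < 1` then `r_j → u/(1−u)` (`r_j ≥ 0`). [folklore] -/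
private theorem tendsto_of_tendsto_div_one_add' {r : ℕ → ℝ} (hr : ∀ j, 0 ≤ r j) {u : ℝ} (hu1 : u < 1)
    (hu : Tendsto (fun j => r j / (1 + r j)) atTop (𝓝 u)) :
    Tendsto r atTop (𝓝 (u / (1 - u))) := by
  have h : Tendsto (fun j => r j / (1 + r j) / (1 - r j / (1 + r j))) atTop (𝓝 (u / (1 - u))) :=
    hu.div (tendsto_const_nhds.sub hu) (by linarith)
  refine h.congr fun j => ?_
  have h1 : (1 + r j) ≠ 0 := by linarith [hr j]
  have h2 : 1 - r j / (1 + r j) = 1 / (1 + r j) := by field_simp; ring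
  rw [h2]
  field_simp

/-- If `r_j/(1+r_j) → 1` then `r_j⁻¹ → 0` (`r_j > 0`). [folklore] -/
private theorem tendsto_inv_of_tendsto_div_one_add' {r : ℕ → ℝ} (hr : ∀ j, 0 < r j)
    (hu : Tendsto (fun j => r j / (1 + r j)) atTop (𝓝 1)) :
    Tendsto (fun j => (r j)⁻¹) atTop (𝓝 0) := by
  have h : Tendsto (fun j => (1 - r j / (1 + r j)) / (r j / (1 + r j))) atTop (𝓝 ((1 - 1) / 1)) :=
    (tendsto_const_nhds.sub hu).div hu one_ne_zero
  rw [sub_self, zero_div] at h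
  refine h.congr fun j => ?_
  have h1 : (1 + r j) ≠ 0 := by linarith [hr j]
  have h2 : 1 - r j / (1 + r j) = 1 / (1 + r j) := by field_simp; ring
  rw [h2]
  field_simp

/-- **For a GIVEN pair `(ω, ω')` the ratio converges to a positive number along a subsequence.** Let `ω`
be a torus limit of the canonical `(rectN n L, S^z = 0)` Gibbs states of `hubbardTorusTT' L t t' U` at
inverse temperature `β` along `Ls → ∞` (`0 < n < 2`) and `ω'` ANY torus limit along the same `Ls` of the
canonical eigen-mixtures of the sectors `(k_L − 1, k_L)`. Then `Z_{(k−1,k)}(Ls (φ j))/Z_{(k,k)}(Ls (φ j)) → r`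
for some strictly increasing `φ` and some `r > 0` (Bolzano–Weierstrass for `u = r/(1+r)`; the «rm↑» rows and
the reversed rows with vanishing fugacity term exclude `u ∈ {0, 1}`). Hence every companion carries joint
data. [cite: BratteliRobinsonII1997, §5.4.2] [cite: FawziFawziScalet2024, Thm. 3.1] -/
theorem InfVolFermionState.IsTorusLimitOfMixture.exists_tendsto_partitionFn_ratio_pos_of_predCompanion
    {n : ℝ} (hn0 : 0 < n) (hn2 : n < 2) {Ls : ℕ → ℕ} (hLs : Tendsto Ls atTop atTop)
    {ω ω' : InfVolFermionState 2}
    (hω : ω.IsTorusLimitOfMixture (sectorGibbsCount n) (fun L => sectorGibbsWeightTT' β t t' U n L)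
      (fun L => sectorGibbsVectorTT' t t' U n L) Ls)
    (hω' : ω'.IsTorusLimitOfMixture
      (fun L => Fintype.card (Subtype (spinConfig (Λ := FermionTorus 2 L) (halfRectN n L - 1) (halfRectN n L))))
      (fun L i => canonicalWeight β (sectorEigenvalue (spinConfig (halfRectN n L - 1) (halfRectN n L))
        (hubbardTorusTT' L t t' U) (hubbardTorusTT'_isHermitian L t t' U)) ((Fintype.equivFin _).symm i))
      (fun L i => sectorEigenvector (spinConfig (halfRectN n L - 1) (halfRectN n L)) (hubbardTorusTT' L t t' U)
        (hubbardTorusTT'_isHermitian L t t' U) ((Fintype.equivFin _).symm i)) Ls) :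
    ∃ φ : ℕ → ℕ, StrictMono φ ∧ ∃ r : ℝ, 0 < r ∧
      Tendsto (fun j =>
        (∑ d, Real.exp (-(β * sectorEigenvalue (spinConfig (halfRectN n (Ls (φ j)) - 1) (halfRectN n (Ls (φ j))))
            (hubbardTorusTT' (Ls (φ j)) t t' U) (hubbardTorusTT'_isHermitian (Ls (φ j)) t t' U) d))) /
          (∑ c, Real.exp (-(β * sectorEigenvalue (szConfig n (Ls (φ j))) (hubbardTorusTT' (Ls (φ j)) t t' U)
            (hubbardTorusTT'_isHermitian (Ls (φ j)) t t' U) c)))) atTop (𝓝 r) := by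
  have hn0' : 0 ≤ n := hn0.le
  have hn2' : n ≤ 2 := hn2.le
  set R : ℕ → ℝ := fun L =>
    (∑ d, Real.exp (-(β * sectorEigenvalue (spinConfig (halfRectN n L - 1) (halfRectN n L))
        (hubbardTorusTT' L t t' U) (hubbardTorusTT'_isHermitian L t t' U) d))) /
      (∑ c, Real.exp (-(β * sectorEigenvalue (szConfig n L) (hubbardTorusTT' L t t' U)
        (hubbardTorusTT'_isHermitian L t t' U) c))) with hR
  have hRpos : ∀ L, 0 < R L := fun L => partitionFn_ratio_predCompanion_pos t t' U β hn0' hn2' L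
  -- Bolzano–Weierstrass for `u = R/(1+R)`
  have humem : ∀ j, R (Ls j) / (1 + R (Ls j)) ∈ Set.Icc (0 : ℝ) 1 := fun j =>
    div_one_add_mem_Icc' (hRpos _).le
  obtain ⟨u, hu, φ, hφ, hlim⟩ := tendsto_subseq_of_bounded (Metric.isBounded_Icc 0 1) humem
  rw [isClosed_Icc.closure_eq] at hu
  have hLsφ : Tendsto (Ls ∘ φ) atTop atTop := hLs.comp hφ.tendsto_atTop
  have hωφ := hω.comp_tendsto hφ.tendsto_atTop
  have hω'φ := hω'.comp_tendsto hφ.tendsto_atTop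
  have hlim' : Tendsto (fun j => R (Ls (φ j)) / (1 + R (Ls (φ j)))) atTop (𝓝 u) := hlim
  -- `u ≠ 0`: the «rm↑» rows with the densities substituted and a vanishing fugacity term
  have hu0 : u ≠ 0 := by
    rintro rfl
    have hr0 : Tendsto (fun j => R (Ls (φ j))) atTop (𝓝 0) := by
      have h := tendsto_of_tendsto_div_one_add' (fun j => (hRpos (Ls (φ j))).le) zero_lt_one hlim'
      rwa [zero_div] at h
    exact not_forall_linear_rows_zero (half_pos hn0) fun s q hq =>
      hωφ.twoSector_row_annihilation_up_densities_of_sectorGibbs t t' U β hn0 hn2' hLsφ hω'φ hr0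
        (Λ := {0}) (x := 0) (Finset.mem_singleton_self 0) hq
  -- `u ≠ 1`: the reversed rows (inverse ratio `→ 0`)
  have hu1 : u ≠ 1 := by
    rintro rfl
    have hr0 : Tendsto (fun j =>
        (∑ c, Real.exp (-(β * sectorEigenvalue (szConfig n (Ls (φ j))) (hubbardTorusTT' (Ls (φ j)) t t' U)
            (hubbardTorusTT'_isHermitian (Ls (φ j)) t t' U) c))) /
          ∑ d, Real.exp (-(β * sectorEigenvalue (spinConfig (halfRectN n (Ls (φ j)) - 1) (halfRectN n (Ls (φ j))))
            (hubbardTorusTT' (Ls (φ j)) t t' U) (hubbardTorusTT'_isHermitian (Ls (φ j)) t t' U) d))) atTop (𝓝 0) := by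
      have h := tendsto_inv_of_tendsto_div_one_add' (fun j => hRpos (Ls (φ j))) hlim'
      refine h.congr fun j => ?_
      rw [hR, inv_div]
    have hy0 : 0 < 1 - n / 2 := by linarith
    have hyeq : (ω'.expect (thicken ({0} : Finset (Site 2)) 1)
        (fermionEmbed (PolySite.incl (subset_thicken {0} 1))
            (annihilation (orb (PolySite.pt (0 : Site 2) (Finset.mem_singleton_self 0)) 0)) *
          (fermionEmbed (PolySite.incl (subset_thicken {0} 1))
            (annihilation (orb (PolySite.pt (0 : Site 2) (Finset.mem_singleton_self 0)) 0)))ᴴ)).re = 1 - n / 2 := by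
      rw [hω'φ.isTranslationInvariant.expect_fermionEmbed_incl_cAt_mul_conjTranspose, Complex.sub_re,
        Complex.one_re, hω'φ.re_expect_nAt_up_eq_half_of_predCompanion t t' U β hn0' hn2' hLsφ]
    exact not_forall_linear_rows_zero hy0 fun s q hq => by
      have h := hωφ.re_expect_twoSector_eeb_creation_up_reverse_nonneg_of_sectorGibbs t t' U β hn0 hLsφ hω'φ hr0
        (Λ := {0}) (x := 0) (Finset.mem_singleton_self 0) hq
      rw [← annihilation_conjTranspose, fermionEmbed_conjTranspose, conjTranspose_conjTranspose, hyeq] at h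
      exact h
  have hu0' : 0 < u := lt_of_le_of_ne hu.1 (Ne.symm hu0)
  have hu1' : u < 1 := lt_of_le_of_ne hu.2 hu1
  exact ⟨φ, hφ, u / (1 - u), div_pos hu0' (by linarith),
    tendsto_of_tendsto_div_one_add' (fun j => (hRpos (Ls (φ j))).le) hu1' hlim'⟩

/-- **A spin sector has at most `C(L², a)·C(L², b)` configurations** (a configuration is determined by its
up- and down-spin site sets). [cite: LiebPRL1989, proof of Theorem 1] -/
theorem card_subtype_spinConfig_le_choose_mul (L a b : ℕ) :
    Fintype.card (Subtype (spinConfig (Λ := FermionTorus 2 L) a b)) ≤ (L ^ 2).choose a * (L ^ 2).choose b := by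
  classical
  let f : Subtype (spinConfig (Λ := FermionTorus 2 L) a b) →
      {α : Finset (FermionTorus 2 L) // α.card = a} × {γ : Finset (FermionTorus 2 L) // γ.card = b} :=
    fun s => (⟨upPart s.1, s.2.1⟩, ⟨downPart s.1, s.2.2⟩)
  have hf : Function.Injective f := by
    rintro ⟨s, hs⟩ ⟨s', hs'⟩ h
    simp only [f, Prod.mk.injEq, Subtype.mk.injEq] at h
    apply Subtype.ext
    show s = s'
    rw [← pairSet_upPart_downPart s, ← pairSet_upPart_downPart s', h.1, h.2]
  have hcard := Fintype.card_le_of_injective f hf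
  rw [Fintype.card_prod, Fintype.card_finset_len, Fintype.card_finset_len] at hcard
  have hΛ : Fintype.card (FermionTorus 2 L) = L ^ 2 := by simp [FermionTorus, sq]
  rwa [hΛ] at hcard

/-- **Binomial entropy bound for a spin sector**: `log #(a, b) ≤ L²·(H_b(a/L²) + H_b(b/L²))` for
`a, b ≤ L²`. [cite: Israel1979, Lemma II.3.1] -/
theorem log_card_subtype_spinConfig_le_binEntropy (L : ℕ) {a b : ℕ} (ha : a ≤ L * L) (hb : b ≤ L * L) :
    Real.log (Fintype.card (Subtype (spinConfig (Λ := FermionTorus 2 L) a b))) ≤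
      (L : ℝ) ^ 2 * (Real.binEntropy ((a : ℝ) / (L : ℝ) ^ 2) + Real.binEntropy ((b : ℝ) / (L : ℝ) ^ 2)) := by
  have ha' : a ≤ L ^ 2 := by rwa [sq]
  have hb' : b ≤ L ^ 2 := by rwa [sq]
  have hpos : 0 < Fintype.card (Subtype (spinConfig (Λ := FermionTorus 2 L) a b)) := by
    obtain ⟨s, hs⟩ := exists_spinConfig_of_le L ha hb
    exact Fintype.card_pos_iff.2 ⟨⟨s, hs⟩⟩
  have hca : (0 : ℝ) < (L ^ 2).choose a := by exact_mod_cast Nat.choose_pos ha'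
  have hcb : (0 : ℝ) < (L ^ 2).choose b := by exact_mod_cast Nat.choose_pos hb'
  calc Real.log (Fintype.card (Subtype (spinConfig (Λ := FermionTorus 2 L) a b)))
      ≤ Real.log ((((L ^ 2).choose a * (L ^ 2).choose b : ℕ) : ℝ)) :=
        Real.log_le_log (by exact_mod_cast hpos) (by exact_mod_cast card_subtype_spinConfig_le_choose_mul L a b)
    _ = Real.log ((L ^ 2).choose a) + Real.log ((L ^ 2).choose b) := by
        rw [Nat.cast_mul, Real.log_mul hca.ne' hcb.ne']
    _ ≤ ((L ^ 2 : ℕ) : ℝ) * Real.binEntropy ((a : ℝ) / ((L ^ 2 : ℕ) : ℝ)) +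
          ((L ^ 2 : ℕ) : ℝ) * Real.binEntropy ((b : ℝ) / ((L ^ 2 : ℕ) : ℝ)) :=
        add_le_add (log_choose_le_mul_binEntropy ha') (log_choose_le_mul_binEntropy hb')
    _ = (L : ℝ) ^ 2 * (Real.binEntropy ((a : ℝ) / (L : ℝ) ^ 2) + Real.binEntropy ((b : ℝ) / (L : ℝ) ^ 2)) := by
        push_cast; ring

/-- **Eventually `log #(k_L − 1, k_L) ≤ s·L²` along `Ls → ∞` for every `s > 2H_b(n/2)`** (`0 ≤ n ≤ 2`): the
companion sector has the same entropy density as the sector of record. [cite: Israel1979, Lemma II.3.1] -/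
theorem eventually_log_card_spinConfig_predCompanion_le {n : ℝ} (hn0 : 0 ≤ n) (hn2 : n ≤ 2) {Ls : ℕ → ℕ}
    (hLs : Tendsto Ls atTop atTop) {s : ℝ} (hs : 2 * Real.binEntropy (n / 2) < s) :
    ∀ᶠ j in atTop, Real.log (Fintype.card (Subtype (spinConfig (Λ := FermionTorus 2 (Ls j))
      (halfRectN n (Ls j) - 1) (halfRectN n (Ls j))))) ≤ s * (Ls j : ℝ) ^ 2 := by
  have hcont : Tendsto (fun j => Real.binEntropy (((halfRectN n (Ls j) - 1 : ℕ) : ℝ) / (Ls j : ℝ) ^ 2) +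
      Real.binEntropy ((halfRectN n (Ls j) : ℝ) / (Ls j : ℝ) ^ 2)) atTop
      (𝓝 (Real.binEntropy (n / 2) + Real.binEntropy (n / 2))) :=
    ((Real.binEntropy_continuous.tendsto _).comp (tendsto_halfRectN_pred_div_sq_comp hn0 hLs)).add
      ((Real.binEntropy_continuous.tendsto _).comp (tendsto_halfRectN_div_sq_comp hn0 hLs))
  rw [← two_mul] at hcont
  filter_upwards [hcont.eventually (gt_mem_nhds hs)] with j hj
  have hL2 : (0 : ℝ) ≤ (Ls j : ℝ) ^ 2 := sq_nonneg _
  calc Real.log (Fintype.card (Subtype (spinConfig (Λ := FermionTorus 2 (Ls j))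
        (halfRectN n (Ls j) - 1) (halfRectN n (Ls j)))))
      ≤ (Ls j : ℝ) ^ 2 * (Real.binEntropy (((halfRectN n (Ls j) - 1 : ℕ) : ℝ) / (Ls j : ℝ) ^ 2) +
          Real.binEntropy ((halfRectN n (Ls j) : ℝ) / (Ls j : ℝ) ^ 2)) :=
        log_card_subtype_spinConfig_le_binEntropy (Ls j)
          ((Nat.sub_le _ _).trans (halfRectN_le_mul_self hn0 hn2 (Ls j))) (halfRectN_le_mul_self hn0 hn2 (Ls j))
    _ ≤ (Ls j : ℝ) ^ 2 * s := mul_le_mul_of_nonneg_left hj.le hL2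
    _ = s * (Ls j : ℝ) ^ 2 := mul_comm _ _

end PredCompanion

/-! ### §2 Energy-window rows of the «rm↑» companion, by name -/

section Windows

variable (t t' U β : ℝ)

/-- A sector eigenvalue of `H_L` on `(rectN n L, S^z = 0)` lies below the `rectN n L`-particle ground energy
(the minimal one equals it). [cite: Tasaki2020, §2.2] -/
theorem exists_sectorEigenvalue_szConfig_le_groundEnergy (L : ℕ) [NeZero L] {n : ℝ} (hn0 : 0 ≤ n) (hn2 : n ≤ 2) :
    ∃ c : Subtype (szConfig n L),
      sectorEigenvalue (szConfig n L) (hubbardTorusTT' L t t' U) (hubbardTorusTT'_isHermitian L t t' U) c ≤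
        groundEnergy (hubbardTorusTT' L t t' U) (rectN n L) := by
  classical
  obtain ⟨s₀, hs₀⟩ := exists_szConfig hn0 hn2 L
  haveI : Nonempty (Subtype (szConfig n L)) := ⟨⟨s₀, hs₀⟩⟩
  set H := hubbardTorusTT' L t t' U with hH
  have hA : H.IsHermitian := hubbardTorusTT'_isHermitian L t t' U
  set hB := hA.submatrix (Subtype.val : Subtype (szConfig n L) → _) with hBdef
  set E : Subtype (szConfig n L) → ℝ := sectorEigenvalue (szConfig n L) H hA with hE
  obtain ⟨c₀, hc₀⟩ : ∃ c₀, E c₀ = ⨅ c, E c := exists_eq_ciInf_of_finite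
  have hground : (H.submatrix (Subtype.val : Subtype (szConfig n L) → _) Subtype.val).groundEnergy = E c₀ := by
    rw [hc₀, Matrix.groundEnergy_eq_iInf_eigenvalues_holds hB]
    rfl
  have hinv : ∀ s s', ¬ szConfig n L s → szConfig n L s' → H s s' = 0 :=
    fun s s' hs hs' => hubbardTorusTT'_apply_eq_zero_of_szConfig L t t' U n s s' hs hs'
  have h1 := groundEnergy_submatrix_le_minEnergyOn (szConfig n L) hA hinv ⟨s₀, hs₀⟩
    (szSector (rectN n L) 0) (mem_szSector_rectN_iff n L)
  have hk : halfRectN n L ≤ Fintype.card (FermionTorus 2 L) := by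
    have h := halfRectN_le_mul_self hn0 hn2 L
    have hΛ : Fintype.card (FermionTorus 2 L) = L * L := by simp [FermionTorus, sq]
    rwa [hΛ]
  have h2 : H.minEnergyOn (szSector (rectN n L) 0) = groundEnergy H (rectN n L) := by
    rw [show rectN n L = 2 * halfRectN n L from rfl, hH, groundEnergy_hubbardTorusTT'_eq_minEnergyOn_szSector L t t' U hk]
  refine ⟨c₀, ?_⟩
  rw [← h2, ← hground]
  exact h1

/-- **The companion's mean energy is within `2H_b(n/2)/β` of the object of record's (upper side).** Let
`ω` be a torus limit of the canonical `(rectN n L, S^z = 0)` Gibbs states of `hubbardTorusTT' L t t' U` at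
`β > 0` along `Ls → ∞` (`0 < n < 2`) and `ω'` any torus limit along the same `Ls` of the canonical
eigen-mixtures of the sectors `(k_L − 1, k_L)`. Then `e_Φ(ω') ≤ e_Φ(ω) + 2·H_b(n/2)/β` (`H_b` = Mathlib's
`Real.binEntropy`, nats). No sign condition on `U`. [cite: Israel1979, Lemma II.3.1]
[cite: BratteliRobinsonII1997, §5.4.2] [cite: Ruelle1969, §3.4] -/
theorem InfVolFermionState.IsTorusLimitOfMixture.meanEnergy_predCompanion_le_meanEnergy_add
    (hβ : 0 < β) {n : ℝ} (hn0 : 0 < n) (hn2 : n < 2) {Ls : ℕ → ℕ} (hLs : Tendsto Ls atTop atTop)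
    {ω ω' : InfVolFermionState 2}
    (hω : ω.IsTorusLimitOfMixture (sectorGibbsCount n) (fun L => sectorGibbsWeightTT' β t t' U n L)
      (fun L => sectorGibbsVectorTT' t t' U n L) Ls)
    (hω' : ω'.IsTorusLimitOfMixture
      (fun L => Fintype.card (Subtype (spinConfig (Λ := FermionTorus 2 L) (halfRectN n L - 1) (halfRectN n L))))
      (fun L i => canonicalWeight β (sectorEigenvalue (spinConfig (halfRectN n L - 1) (halfRectN n L))
        (hubbardTorusTT' L t t' U) (hubbardTorusTT'_isHermitian L t t' U)) ((Fintype.equivFin _).symm i))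
      (fun L i => sectorEigenvector (spinConfig (halfRectN n L - 1) (halfRectN n L)) (hubbardTorusTT' L t t' U)
        (hubbardTorusTT'_isHermitian L t t' U) ((Fintype.equivFin _).symm i)) Ls) :
    ω'.meanEnergy (hubbardTTPrimeFermionInteraction t t' U) 1 ≤
      ω.meanEnergy (hubbardTTPrimeFermionInteraction t t' U) 1 + 2 * Real.binEntropy (n / 2) / β := by
  have hn0' : 0 ≤ n := hn0.le
  have hn2' : n ≤ 2 := hn2.le
  obtain ⟨φ, hφ, r, hr0, hr⟩ := hω.exists_tendsto_partitionFn_ratio_pos_of_predCompanion t t' U β hn0 hn2 hLs hω'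
  have hLsφ : Tendsto (Ls ∘ φ) atTop atTop := hLs.comp hφ.tendsto_atTop
  refine le_of_forall_pos_le_add fun ε hε => ?_
  have hs : 2 * Real.binEntropy (n / 2) < 2 * Real.binEntropy (n / 2) + β * ε := by
    linarith [mul_pos hβ hε]
  have hev := eventually_log_card_spinConfig_predCompanion_le hn0' hn2' hLsφ hs
  have hcap := InfVolFermionState.IsTorusLimitOfMixture.meanEnergy_le_meanEnergy_add_of_partitionRatio t t' U β hβ
    (fun L => szConfig n L) (fun L => spinConfig (Λ := FermionTorus 2 L) (halfRectN n L - 1) (halfRectN n L))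
    (fun L s s' hs hs' => hubbardTorusTT'_apply_eq_zero_of_szConfig L t t' U n s s' hs hs')
    (fun L s s' hs hs' => hubbardTorusTT'_apply_eq_zero_of_spinConfig L t t' U _ _ s s' hs hs')
    (fun L => sectorGibbsIndex n L) (fun L => (Fintype.equivFin _).symm)
    (sectorGibbsWeightTT'_eq_canonicalWeight t t' U β n) (fun L i => rfl) (fun L i => rfl) (fun L i => rfl)
    hLsφ (hω.comp_tendsto hφ.tendsto_atTop) (hω'.comp_tendsto hφ.tendsto_atTop)
    (Eventually.of_forall fun j => by
      obtain ⟨s₀, hs₀⟩ := exists_szConfig hn0' hn2' (Ls (φ j))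
      exact ⟨⟨s₀, hs₀⟩⟩)
    (Eventually.of_forall fun j => by
      obtain ⟨s₁, hs₁⟩ := exists_spinConfig_of_le (Ls (φ j))
        ((Nat.sub_le _ _).trans (halfRectN_le_mul_self hn0' hn2' _)) (halfRectN_le_mul_self hn0' hn2' _)
      exact ⟨⟨s₁, hs₁⟩⟩)
    hr0 hr hev
  have hsplit : (2 * Real.binEntropy (n / 2) + β * ε) / β = 2 * Real.binEntropy (n / 2) / β + ε := by
    rw [add_div, mul_div_assoc, mul_div_cancel_left₀ ε hβ.ne']
  linarith [hcap, hsplit]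

/-- **… and the lower side**: `e_Φ(ω) ≤ e_Φ(ω') + 2·H_b(n/2)/β` (the same argument with the sectors
exchanged and the inverse ratio). [cite: Israel1979, Lemma II.3.1] [cite: BratteliRobinsonII1997, §5.4.2]
[cite: Ruelle1969, §3.4] -/
theorem InfVolFermionState.IsTorusLimitOfMixture.meanEnergy_le_meanEnergy_predCompanion_add
    (hβ : 0 < β) {n : ℝ} (hn0 : 0 < n) (hn2 : n < 2) {Ls : ℕ → ℕ} (hLs : Tendsto Ls atTop atTop)
    {ω ω' : InfVolFermionState 2}
    (hω : ω.IsTorusLimitOfMixture (sectorGibbsCount n) (fun L => sectorGibbsWeightTT' β t t' U n L)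
      (fun L => sectorGibbsVectorTT' t t' U n L) Ls)
    (hω' : ω'.IsTorusLimitOfMixture
      (fun L => Fintype.card (Subtype (spinConfig (Λ := FermionTorus 2 L) (halfRectN n L - 1) (halfRectN n L))))
      (fun L i => canonicalWeight β (sectorEigenvalue (spinConfig (halfRectN n L - 1) (halfRectN n L))
        (hubbardTorusTT' L t t' U) (hubbardTorusTT'_isHermitian L t t' U)) ((Fintype.equivFin _).symm i))
      (fun L i => sectorEigenvector (spinConfig (halfRectN n L - 1) (halfRectN n L)) (hubbardTorusTT' L t t' U)
        (hubbardTorusTT'_isHermitian L t t' U) ((Fintype.equivFin _).symm i)) Ls) :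
    ω.meanEnergy (hubbardTTPrimeFermionInteraction t t' U) 1 ≤
      ω'.meanEnergy (hubbardTTPrimeFermionInteraction t t' U) 1 + 2 * Real.binEntropy (n / 2) / β := by
  have hn0' : 0 ≤ n := hn0.le
  have hn2' : n ≤ 2 := hn2.le
  obtain ⟨φ, hφ, r, hr0, hr⟩ := hω.exists_tendsto_partitionFn_ratio_pos_of_predCompanion t t' U β hn0 hn2 hLs hω'
  have hLsφ : Tendsto (Ls ∘ φ) atTop atTop := hLs.comp hφ.tendsto_atTop
  have hr' : Tendsto (fun j =>
      (∑ c, Real.exp (-(β * sectorEigenvalue (szConfig n (Ls (φ j))) (hubbardTorusTT' (Ls (φ j)) t t' U)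
          (hubbardTorusTT'_isHermitian (Ls (φ j)) t t' U) c))) /
        ∑ d, Real.exp (-(β * sectorEigenvalue (spinConfig (halfRectN n (Ls (φ j)) - 1) (halfRectN n (Ls (φ j))))
          (hubbardTorusTT' (Ls (φ j)) t t' U) (hubbardTorusTT'_isHermitian (Ls (φ j)) t t' U) d))) atTop (𝓝 r⁻¹) := by
    refine (hr.inv₀ hr0.ne').congr fun j => ?_
    rw [inv_div]
  refine le_of_forall_pos_le_add fun ε hε => ?_
  have hs : 2 * Real.binEntropy (n / 2) < 2 * Real.binEntropy (n / 2) + β * ε := by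
    linarith [mul_pos hβ hε]
  have hev : ∀ᶠ j in atTop, Real.log (Fintype.card (Subtype (szConfig n ((Ls ∘ φ) j)))) ≤
      (2 * Real.binEntropy (n / 2) + β * ε) * (((Ls ∘ φ) j : ℕ) : ℝ) ^ 2 :=
    (hLsφ.eventually (eventually_log_sectorGibbsCount_le hn0' hn2' hs)).mono fun j hj => hj
  have hcap := InfVolFermionState.IsTorusLimitOfMixture.meanEnergy_le_meanEnergy_add_of_partitionRatio t t' U β hβ
    (fun L => spinConfig (Λ := FermionTorus 2 L) (halfRectN n L - 1) (halfRectN n L)) (fun L => szConfig n L)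
    (fun L s s' hs hs' => hubbardTorusTT'_apply_eq_zero_of_spinConfig L t t' U _ _ s s' hs hs')
    (fun L s s' hs hs' => hubbardTorusTT'_apply_eq_zero_of_szConfig L t t' U n s s' hs hs')
    (fun L => (Fintype.equivFin _).symm) (fun L => sectorGibbsIndex n L)
    (fun L i => rfl) (fun L i => rfl) (sectorGibbsWeightTT'_eq_canonicalWeight t t' U β n) (fun L i => rfl)
    hLsφ (hω'.comp_tendsto hφ.tendsto_atTop) (hω.comp_tendsto hφ.tendsto_atTop)
    (Eventually.of_forall fun j => by
      obtain ⟨s₁, hs₁⟩ := exists_spinConfig_of_le (Ls (φ j))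
        ((Nat.sub_le _ _).trans (halfRectN_le_mul_self hn0' hn2' _)) (halfRectN_le_mul_self hn0' hn2' _)
      exact ⟨⟨s₁, hs₁⟩⟩)
    (Eventually.of_forall fun j => by
      obtain ⟨s₀, hs₀⟩ := exists_szConfig hn0' hn2' (Ls (φ j))
      exact ⟨⟨s₀, hs₀⟩⟩)
    (inv_pos.2 hr0) hr' hev
  have hsplit : (2 * Real.binEntropy (n / 2) + β * ε) / β = 2 * Real.binEntropy (n / 2) / β + ε := by
    rw [add_div, mul_div_assoc, mul_div_cancel_left₀ ε hβ.ne']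
  linarith [hcap, hsplit]

/-- **Energy FLOOR for the companion**: `e(t,t',U,n) ≤ e_Φ(ω')` (`U ≥ 0`, `0 < n < 2`) — the companion is
translation invariant with density `n` (`n/2 + n/2`), so the variational principle for the ground-state
energy density applies. [cite: Ruelle1969, §3.4] -/
theorem InfVolFermionState.IsTorusLimitOfMixture.energyDensityTT'_le_meanEnergy_predCompanion
    (hU : 0 ≤ U) {n : ℝ} (hn0 : 0 < n) (hn2 : n < 2) {Ls : ℕ → ℕ} (hLs : Tendsto Ls atTop atTop)
    {ω' : InfVolFermionState 2}
    (hω' : ω'.IsTorusLimitOfMixture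
      (fun L => Fintype.card (Subtype (spinConfig (Λ := FermionTorus 2 L) (halfRectN n L - 1) (halfRectN n L))))
      (fun L i => canonicalWeight β (sectorEigenvalue (spinConfig (halfRectN n L - 1) (halfRectN n L))
        (hubbardTorusTT' L t t' U) (hubbardTorusTT'_isHermitian L t t' U)) ((Fintype.equivFin _).symm i))
      (fun L i => sectorEigenvector (spinConfig (halfRectN n L - 1) (halfRectN n L)) (hubbardTorusTT' L t t' U)
        (hubbardTorusTT'_isHermitian L t t' U) ((Fintype.equivFin _).symm i)) Ls) :
    energyDensityTT' t t' U n ≤ ω'.meanEnergy (hubbardTTPrimeFermionInteraction t t' U) 1 := by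
  have hρ : ω'.density = n := by
    rw [InfVolFermionState.density, InfVolFermionState.densityAt, map_add, Complex.add_re,
      hω'.re_expect_nAt_up_eq_half_of_predCompanion t t' U β hn0.le hn2.le hLs,
      hω'.re_expect_nAt_down_eq_half_of_predCompanion t t' U β hn0.le hn2.le hLs]
    ring
  exact InfVolFermionState.energyDensityTT'_le_meanEnergy_of_isTranslationInvariant t t' hU hn0 hn2
    hω'.isTranslationInvariant hρ

/-- **Energy CAP for the companion, joint-data form**: for `ω`, `ω'` along the same `Ls` with
`Z_{(k−1,k)}/Z_{(k,k)} → r` (`β > 0`, `U ≥ 0`, `0 < n < 2`): `e_Φ(ω') ≤ e(t,t',U,n) + 2·H_b(n/2)/β` (finite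
volume: `β⟨E'⟩ ≤ log #P' + β·E₀(L; rectN n L) − log(Z'/Z)`, `E₀/L² → e(n)`, `log #P'/L² → 2H_b(n/2)`,
`log(Z'/Z)/L² → 0` since `r > 0` automatically). [cite: Israel1979, Lemma II.3.1] [cite: Ruelle1969, §3.4]
[cite: BratteliRobinsonII1997, §5.4.2] -/
theorem InfVolFermionState.IsTorusLimitOfMixture.meanEnergy_predCompanion_le_energyDensityTT'_add_of_tendsto
    (hβ : 0 < β) (hU : 0 ≤ U) {n : ℝ} (hn0 : 0 < n) (hn2 : n < 2) {Ls : ℕ → ℕ}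
    (hLs : Tendsto Ls atTop atTop) {ω ω' : InfVolFermionState 2}
    (hω : ω.IsTorusLimitOfMixture (sectorGibbsCount n) (fun L => sectorGibbsWeightTT' β t t' U n L)
      (fun L => sectorGibbsVectorTT' t t' U n L) Ls)
    (hω' : ω'.IsTorusLimitOfMixture
      (fun L => Fintype.card (Subtype (spinConfig (Λ := FermionTorus 2 L) (halfRectN n L - 1) (halfRectN n L))))
      (fun L i => canonicalWeight β (sectorEigenvalue (spinConfig (halfRectN n L - 1) (halfRectN n L))
        (hubbardTorusTT' L t t' U) (hubbardTorusTT'_isHermitian L t t' U)) ((Fintype.equivFin _).symm i))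
      (fun L i => sectorEigenvector (spinConfig (halfRectN n L - 1) (halfRectN n L)) (hubbardTorusTT' L t t' U)
        (hubbardTorusTT'_isHermitian L t t' U) ((Fintype.equivFin _).symm i)) Ls)
    {r : ℝ} (hr : Tendsto (fun j =>
      (∑ d, Real.exp (-(β * sectorEigenvalue (spinConfig (halfRectN n (Ls j) - 1) (halfRectN n (Ls j)))
          (hubbardTorusTT' (Ls j) t t' U) (hubbardTorusTT'_isHermitian (Ls j) t t' U) d))) /
        ∑ c, Real.exp (-(β * sectorEigenvalue (szConfig n (Ls j)) (hubbardTorusTT' (Ls j) t t' U)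
          (hubbardTorusTT'_isHermitian (Ls j) t t' U) c))) atTop (𝓝 r)) :
    ω'.meanEnergy (hubbardTTPrimeFermionInteraction t t' U) 1 ≤
      energyDensityTT' t t' U n + 2 * Real.binEntropy (n / 2) / β := by
  have hn0' : 0 ≤ n := hn0.le
  have hn2' : n ≤ 2 := hn2.le
  have hr0 := hω.pos_of_tendsto_partitionFn_ratio_predCompanion t t' U β hn0 hn2' hLs hω' hr
  set R : ℕ → ℝ := fun j =>
    (∑ d, Real.exp (-(β * sectorEigenvalue (spinConfig (halfRectN n (Ls j) - 1) (halfRectN n (Ls j)))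
        (hubbardTorusTT' (Ls j) t t' U) (hubbardTorusTT'_isHermitian (Ls j) t t' U) d))) /
      (∑ c, Real.exp (-(β * sectorEigenvalue (szConfig n (Ls j)) (hubbardTorusTT' (Ls j) t t' U)
        (hubbardTorusTT'_isHermitian (Ls j) t t' U) c))) with hR
  refine le_of_forall_pos_le_add fun ε hε => ?_
  set s := 2 * Real.binEntropy (n / 2) + β * ε with hsdef
  have hs : 2 * Real.binEntropy (n / 2) < s := by rw [hsdef]; linarith [mul_pos hβ hε]
  have hev := eventually_log_card_spinConfig_predCompanion_le hn0' hn2' hLs hs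
  have h1' := hω'.tendsto_meanEnergy_hubbardTTPrime t t' U hLs
  have he := (tendsto_energyDensityTT'_torus t t' hU hn0' hn2).comp hLs
  have hlog : Tendsto (fun j => Real.log (R j) / (β * (Ls j : ℝ) ^ 2)) atTop (𝓝 0) := by
    have hnum : Tendsto (fun j => Real.log (R j)) atTop (𝓝 (Real.log r)) :=
      (Real.continuousAt_log hr0.ne').tendsto.comp hr
    have hden : Tendsto (fun j => β * (Ls j : ℝ) ^ 2) atTop atTop :=
      ((tendsto_pow_atTop two_ne_zero).comp (tendsto_natCast_atTop_atTop.comp hLs)).const_mul_atTop hβ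
    exact hnum.div_atTop hden
  have h2 : Tendsto (fun j => groundEnergy (hubbardTorusTT' (Ls j) t t' U) (rectN n (Ls j)) / (Ls j : ℝ) ^ 2 +
      s / β - Real.log (R j) / (β * (Ls j : ℝ) ^ 2)) atTop (𝓝 (energyDensityTT' t t' U n + s / β - 0)) :=
    (he.add_const (s / β)).sub hlog
  rw [sub_zero] at h2
  have hmain : ω'.meanEnergy (hubbardTTPrimeFermionInteraction t t' U) 1 ≤ energyDensityTT' t t' U n + s / β := by
    refine le_of_tendsto_of_tendsto h1' h2 ?_
    filter_upwards [hev, hLs.eventually_ge_atTop 1] with j hSj hj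
    haveI : NeZero (Ls j) := ⟨by omega⟩
    obtain ⟨s₁, hs₁⟩ := exists_spinConfig_of_le (Ls j)
      ((Nat.sub_le _ _).trans (halfRectN_le_mul_self hn0' hn2' _)) (halfRectN_le_mul_self hn0' hn2' _)
    haveI : Nonempty (Subtype (spinConfig (Λ := FermionTorus 2 (Ls j)) (halfRectN n (Ls j) - 1) (halfRectN n (Ls j)))) :=
      ⟨⟨s₁, hs₁⟩⟩
    obtain ⟨s₀, hs₀⟩ := exists_szConfig hn0' hn2' (Ls j)
    haveI : Nonempty (Subtype (szConfig n (Ls j))) := ⟨⟨s₀, hs₀⟩⟩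
    have hL2 : (0 : ℝ) < (Ls j : ℝ) ^ 2 := by
      have : (1 : ℝ) ≤ Ls j := by exact_mod_cast hj
      positivity
    have hβL : (0 : ℝ) < β * (Ls j : ℝ) ^ 2 := mul_pos hβ hL2
    obtain ⟨c₀, hc₀⟩ := exists_sectorEigenvalue_szConfig_le_groundEnergy t t' U (Ls j) hn0' hn2'
    have key := mul_gibbsMean_le_level_of_partitionRatio β
      (sectorEigenvalue (szConfig n (Ls j)) (hubbardTorusTT' (Ls j) t t' U) (hubbardTorusTT'_isHermitian (Ls j) t t' U))
      (sectorEigenvalue (spinConfig (halfRectN n (Ls j) - 1) (halfRectN n (Ls j))) (hubbardTorusTT' (Ls j) t t' U)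
        (hubbardTorusTT'_isHermitian (Ls j) t t' U)) c₀
    rw [← sum_presentation_mul_re_expect_eq_gibbsMean t t' U β
      (fun s s' hs hs' => hubbardTorusTT'_apply_eq_zero_of_spinConfig (Ls j) t t' U _ _ s s' hs hs')
      ((Fintype.equivFin _).symm) (fun i => rfl) (fun i => rfl)] at key
    set A := ∑ i, canonicalWeight β (sectorEigenvalue (spinConfig (halfRectN n (Ls j) - 1) (halfRectN n (Ls j)))
        (hubbardTorusTT' (Ls j) t t' U) (hubbardTorusTT'_isHermitian (Ls j) t t' U)) ((Fintype.equivFin _).symm i) *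
      (QuantumLattice.expect (hubbardTorusTT' (Ls j) t t' U)
        (sectorEigenvector (spinConfig (halfRectN n (Ls j) - 1) (halfRectN n (Ls j))) (hubbardTorusTT' (Ls j) t t' U)
          (hubbardTorusTT'_isHermitian (Ls j) t t' U) ((Fintype.equivFin _).symm i))).re with hA
    have hsumA : ∑ i, canonicalWeight β (sectorEigenvalue (spinConfig (halfRectN n (Ls j) - 1) (halfRectN n (Ls j)))
        (hubbardTorusTT' (Ls j) t t' U) (hubbardTorusTT'_isHermitian (Ls j) t t' U)) ((Fintype.equivFin _).symm i) *
      ((QuantumLattice.expect (hubbardTorusTT' (Ls j) t t' U)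
        (sectorEigenvector (spinConfig (halfRectN n (Ls j) - 1) (halfRectN n (Ls j))) (hubbardTorusTT' (Ls j) t t' U)
          (hubbardTorusTT'_isHermitian (Ls j) t t' U) ((Fintype.equivFin _).symm i))).re / (Ls j : ℝ) ^ 2) =
        A / (Ls j : ℝ) ^ 2 := by
      rw [hA, Finset.sum_div]
      refine Finset.sum_congr rfl fun i _ => ?_
      ring
    rw [hsumA]
    have key' : β * A ≤ s * (Ls j : ℝ) ^ 2 +
        β * groundEnergy (hubbardTorusTT' (Ls j) t t' U) (rectN n (Ls j)) - Real.log (R j) := by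
      rw [hR]
      nlinarith [mul_le_mul_of_nonneg_left hc₀ hβ.le, hSj, key]
    calc A / (Ls j : ℝ) ^ 2 = β * A / (β * (Ls j : ℝ) ^ 2) := by
          field_simp
      _ ≤ (s * (Ls j : ℝ) ^ 2 + β * groundEnergy (hubbardTorusTT' (Ls j) t t' U) (rectN n (Ls j)) -
            Real.log (R j)) / (β * (Ls j : ℝ) ^ 2) :=
          div_le_div_of_nonneg_right key' hβL.le
      _ = groundEnergy (hubbardTorusTT' (Ls j) t t' U) (rectN n (Ls j)) / (Ls j : ℝ) ^ 2 + s / β -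
            Real.log (R j) / (β * (Ls j : ℝ) ^ 2) := by
          field_simp
          ring
  have hsplit : s / β = 2 * Real.binEntropy (n / 2) / β + ε := by
    rw [hsdef, add_div, mul_div_assoc, mul_div_cancel_left₀ ε hβ.ne']
  linarith [hmain, hsplit]

/-- **Energy CAP for the companion: the same N2′ cap as for the object of record, hypothesis-free.** For
`ω` a torus limit of the canonical `(rectN n L, S^z = 0)` Gibbs states at `β > 0` along `Ls → ∞`
(`U ≥ 0`, `0 < n < 2`) and ANY companion torus limit `ω'` of the sectors `(k_L − 1, k_L)` along the same `Ls`: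
`e_Φ(ω') ≤ e(t,t',U,n) + 2·H_b(n/2)/β`. [cite: Israel1979, Lemma II.3.1] [cite: Ruelle1969, §3.4]
[cite: BratteliRobinsonII1997, §5.4.2] -/
theorem InfVolFermionState.IsTorusLimitOfMixture.meanEnergy_predCompanion_le_energyDensityTT'_add
    (hβ : 0 < β) (hU : 0 ≤ U) {n : ℝ} (hn0 : 0 < n) (hn2 : n < 2) {Ls : ℕ → ℕ}
    (hLs : Tendsto Ls atTop atTop) {ω ω' : InfVolFermionState 2}
    (hω : ω.IsTorusLimitOfMixture (sectorGibbsCount n) (fun L => sectorGibbsWeightTT' β t t' U n L)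
      (fun L => sectorGibbsVectorTT' t t' U n L) Ls)
    (hω' : ω'.IsTorusLimitOfMixture
      (fun L => Fintype.card (Subtype (spinConfig (Λ := FermionTorus 2 L) (halfRectN n L - 1) (halfRectN n L))))
      (fun L i => canonicalWeight β (sectorEigenvalue (spinConfig (halfRectN n L - 1) (halfRectN n L))
        (hubbardTorusTT' L t t' U) (hubbardTorusTT'_isHermitian L t t' U)) ((Fintype.equivFin _).symm i))
      (fun L i => sectorEigenvector (spinConfig (halfRectN n L - 1) (halfRectN n L)) (hubbardTorusTT' L t t' U)
        (hubbardTorusTT'_isHermitian L t t' U) ((Fintype.equivFin _).symm i)) Ls) :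
    ω'.meanEnergy (hubbardTTPrimeFermionInteraction t t' U) 1 ≤
      energyDensityTT' t t' U n + 2 * Real.binEntropy (n / 2) / β := by
  obtain ⟨φ, hφ, r, -, hr⟩ := hω.exists_tendsto_partitionFn_ratio_pos_of_predCompanion t t' U β hn0 hn2 hLs hω'
  exact InfVolFermionState.IsTorusLimitOfMixture.meanEnergy_predCompanion_le_energyDensityTT'_add_of_tendsto
    t t' U β hβ hU hn0 hn2 (hLs.comp hφ.tendsto_atTop) (hω.comp_tendsto hφ.tendsto_atTop)
    (hω'.comp_tendsto hφ.tendsto_atTop) hr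

/-- **The companion's thermal energy window, assembled** (`β > 0`, `U ≥ 0`, `0 < n < 2`):
`e(n) ≤ e_Φ(ω') ≤ e(n) + 2·H_b(n/2)/β` — the same window as the object of record's N2′ row
(`…meanEnergy_hubbardTTPrime_le_energyDensityTT'_add_binEntropy_div`), so every `T = 0` filling-box
energy row transports to the companion classes exactly as to `ω`. [cite: Israel1979, Lemma II.3.1]
[cite: Ruelle1969, §3.4] -/
theorem InfVolFermionState.IsTorusLimitOfMixture.meanEnergy_predCompanion_mem_Icc
    (hβ : 0 < β) (hU : 0 ≤ U) {n : ℝ} (hn0 : 0 < n) (hn2 : n < 2) {Ls : ℕ → ℕ}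
    (hLs : Tendsto Ls atTop atTop) {ω ω' : InfVolFermionState 2}
    (hω : ω.IsTorusLimitOfMixture (sectorGibbsCount n) (fun L => sectorGibbsWeightTT' β t t' U n L)
      (fun L => sectorGibbsVectorTT' t t' U n L) Ls)
    (hω' : ω'.IsTorusLimitOfMixture
      (fun L => Fintype.card (Subtype (spinConfig (Λ := FermionTorus 2 L) (halfRectN n L - 1) (halfRectN n L))))
      (fun L i => canonicalWeight β (sectorEigenvalue (spinConfig (halfRectN n L - 1) (halfRectN n L))
        (hubbardTorusTT' L t t' U) (hubbardTorusTT'_isHermitian L t t' U)) ((Fintype.equivFin _).symm i))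
      (fun L i => sectorEigenvector (spinConfig (halfRectN n L - 1) (halfRectN n L)) (hubbardTorusTT' L t t' U)
        (hubbardTorusTT'_isHermitian L t t' U) ((Fintype.equivFin _).symm i)) Ls) :
    ω'.meanEnergy (hubbardTTPrimeFermionInteraction t t' U) 1 ∈
      Set.Icc (energyDensityTT' t t' U n) (energyDensityTT' t t' U n + 2 * Real.binEntropy (n / 2) / β) :=
  ⟨hω'.energyDensityTT'_le_meanEnergy_predCompanion t t' U β hU hn0 hn2 hLs,
    hω.meanEnergy_predCompanion_le_energyDensityTT'_add t t' U β hβ hU hn0 hn2 hLs hω'⟩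

end Windows

end Literature.MathematicalPhysics.QuantumLattice

end
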